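import Summits.CriticalPhenomena.PercolationContinuityZ3.Theorems.PercNearOneGluingNoHeavyLowerTailMajorityGluingQCertSym3TypeParts
import Summits.CriticalPhenomena.PercolationContinuityZ3.Theorems.PercNearOneGluingNoHeavyLowerTailMajorityGluingQCertSym3Fast
import HarnessLib

/-!
# Type-space checker with FAST keys for the enumerated squares (lane prim-rate, constants-miner 1, gen 37; census/g37/TYPE-SPACE-CHECKER.md)

Support file for the closed crux `NoHeavyLowerTail` (stmt-CriticalPhenomena-4575), majority-gluing line.  `SymCert3.contribs3Y` (…QCertSym3TypeCheck) keeps the squares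
ENUMERATED through `sqC3S`, i.e. with the slow list-based key `keyS3` — in the kernel that is ≈ 10 ms and much garbage per contribution (a 71 000-contribution part ran out of
memory, p600985).  Here the same list with the squares filed under the FAST key (`sqC3T` of …QCertSym3Fast): `contribs3YF = contribs3Y` (by `keyT = keyS3`), hence
`digest3YF = digest3Y` and `check3YF = check3Y` — a part proves `d.digest3Y fuel = D` by `rw [← SymCert3.digest3YF_eq]; decide +kernel`.  No sorries.
-/

noncomputable section

namespace Summit.CriticalPhenomena.PercolationContinuityZ3.Theorems

namespace HubOnly
namespace QCert
namespace SymCert3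

variable (c : SymCert3)

/-- Type-space contributions with the enumerated squares under the fast key. -/
def contribs3YF : List (ℕ × ℤ) :=
  (c.ell2.map c.ell2Y).flatten ++ (c.lin.map c.linY).flatten ++
    (c.rows.map fun ch => (ch.map c.rowY).flatten).flatten ++ (c.sqs.map fun ch => (ch.map c.sqC3T).flatten).flatten

/-- It is the type-space contribution list. -/
theorem contribs3YF_eq : c.contribs3YF = c.contribs3Y := by
  have h5 : c.sqC3T = c.sqC3S := by
    funext s; simp only [sqC3T, sqC3S, keyF, key, keyT_eq]
  rw [contribs3YF, contribs3Y, h5]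

/-- The type-space digest computed with fast square keys. -/
def digest3YF (fuel : ℕ) : List (ℕ × ℤ) := aggr (msort2 fuel c.contribs3YF)

/-- It is `digest3Y`. -/
theorem digest3YF_eq (fuel : ℕ) : c.digest3YF fuel = c.digest3Y fuel := by
  unfold digest3YF digest3Y; rw [contribs3YF_eq]

/-- The type-space key check computed with fast square keys. -/
def checkQ3YF (fuel : ℕ) : Bool := runsOK (msort2 fuel c.contribs3YF)

/-- It is `checkQ3Y`. -/
theorem checkQ3YF_eq (fuel : ℕ) : c.checkQ3YF fuel = c.checkQ3Y fuel := by
  unfold checkQ3YF checkQ3Y; rw [contribs3YF_eq]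

/-- The full check with fast square keys. -/
def check3YF (fuel : ℕ) : Bool := c.checkW3S && c.checkQ3YF fuel

/-- It is `check3Y`: a one-file certificate proves `c.check3Y fuel = true` by `rw [← SymCert3.check3YF_eq]; decide +kernel`. -/
theorem check3YF_eq (fuel : ℕ) : c.check3YF fuel = c.check3Y fuel := by
  unfold check3YF check3Y; rw [checkQ3YF_eq]

/-- Smoke test (kernel). -/
theorem sym3Smoke_checkYF : sym3Smoke.check3YF 8 = true := by decide +kernel

end SymCert3
end QCert
end HubOnly

end Summit.CriticalPhenomena.PercolationContinuityZ3.Theorems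

end
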